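import Summits.CriticalPhenomena.PercolationContinuityZ3.Theorems.PercNearOneGluingAdditiveGluingFingerDomination
import Summits.CriticalPhenomena.PercolationContinuityZ3.Theorems.PercNearOneGluingAdditiveGluingFingersT
import HarnessLib

/-! # Crux `PercNearOneGluing.AdditiveGluing` (stmt-CriticalPhenomena-4576) — `AdditiveGluing` for the whole FINGER CLASS from the
# domination inequality DI-K / DI-R alone (seat (b) V⁺-form, depth prover `png-dp-vplus`, gen 5)

Support file (`--supports stmt-CriticalPhenomena-4576`); no definitions, no named facts; the open inequality enters as a HYPOTHESIS (`hDI`).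
Companions: `…AdditiveGluingFingersT.lean` (`additiveGluing_fingers_of_T_at`: the finger class needs only the T-form
`0 ≤ μ_g(N ↮ A) + μ_g(N ↔ b) − μ_g(d ↔ b)` for every finger block, `g = K/N`), `…AdditiveGluingFingerDomination.lean` (star form, DI-K reduction
of the registered stub `stub_fingerML3_vp`).

**Theorem (`additiveGluing_fingers_of_domination`).**  Suppose that for every weighting `K`, relay set `A ∋ b`, finger block `N` and designated
relay `d ∈ A` that is weakest in the UNGLUED weighting (`μ_K(d↔b) ≤ μ_K(a↔b)` for all `a ∈ A`) SOME relay `u ∈ A` satisfies the domination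
inequality
  (DI)  `μ_K(R ∩ {u↔b}) + μ_K(U ∩ {d↔N} ∩ {d↮b}) ≤ μ_K(U)`,   `R` = some pair `N–A` open, `U = ⋃_{v∈N}{v↔b}`
(the depth prover's conjecture DI-K takes `u` = the contact minimising `μ_K(·↔b)`; DI-R takes any minimiser of `μ_K(R ∩ {·↔b})`; both are
hypothesis-free statements about one percolation measure, 0 violations in 9·10⁸ exhaustive exact-structure instances, memo MEMO-gen5).  Then
`AdditiveGluing` holds for every observer all of whose non-relay neighbours are fingers.
Unlike the route through the stub (`fingerML3_of_domination`, which also needs `μ_K(R∩{d↔b}) ≤ μ_K(R∩{u↔b})`), NO comparison on `R` is needed here: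
the T-form has the slack `μ_g(N↮A) − μ_g(N↮A, d↔b) = Ψ(1 − μ_q(d↔b))`, and the plain hypothesis `μ_K(d↔b) ≤ μ_K(u↔b)` pays the rest.
**Proof.**  Pull the three glued measures back to `K` (`stub_gluePushforward`): `U` and `⋃_{v,a}{v↔a}` are gluing-invariant, and
`{d↔b}` pulls back to `{d↔b} ∪ ({d↔N} ∩ U)` (last-exit lemma `reachable_or_exists_mem_of_glue` applied to the walk and to its reverse); then
`μ_g(d↔b) ≤ μ_K(d↔b) + μ_K(U ∩ {d↔N} ∩ {d↮b}) ≤ μ_K(u↔b) + [μ_K(U) − μ_K(R∩{u↔b})] ≤ μ_K(U) + μ_K(Rᶜ) ≤ μ_g(N↔b) + μ_g(N↮A)`, the last step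
because off `R` no finger reaches a relay (`finger_noContact_reach_null`).
[cite: KozmaNitzan2024, Thm 4–5 and Lemma 5 (§3.2, pp. 12–14), eq. (3) p. 3, §3.1 (gluing)]
-/

namespace Summit.CriticalPhenomena.PercolationContinuityZ3.Theorems

open MeasureTheory Set
open Literature.Probability.LatticeModels (prodBernoulli)
open Literature.Probability.Percolation (BondConfig openConn openGraph)

noncomputable section
open Classical

section FingersDominationAG

open Literature.Probability.LatticeModels Literature.Probability.Percolation

variable {n : ℕ}

/-- **Pull-back of `{d ↔ b}` under gluing the block** (`d ∉ N`): after adding all non-loop pairs inside `N`, `d ↔ b` iff `d ↔ b` already,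
or `d` is joined to some vertex of `N` and some vertex of `N` is joined to `b` (last exit from / first entry into the block). [folklore] -/
theorem glue_preimage_openConn_eq (N : Finset (Fin n)) (d b : Fin n) :
    {ω : BondConfig (Fin n) | (ω ∪ {e : Sym2 (Fin n) | (∀ x ∈ e, x ∈ N) ∧ ¬ e.IsDiag} : BondConfig (Fin n)) ∈
        (openConn d b : Set (BondConfig (Fin n)))} =
      openConn d b ∪ ({ω : BondConfig (Fin n) | ∃ x ∈ (↑N : Set (Fin n)), (openGraph ω).Reachable d x} ∩
        ⋃ v ∈ N, (openConn v b : Set (BondConfig (Fin n)))) := by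
  ext ω
  simp only [Set.mem_setOf_eq, Set.mem_union, Set.mem_inter_iff, Set.mem_iUnion, exists_prop]
  constructor
  · intro h
    have h1 := reachable_or_exists_mem_of_glue N (u := d) (y := b) h
    have h2 := reachable_or_exists_mem_of_glue N (u := b) (y := d) (SimpleGraph.Reachable.symm h)
    rcases h1 with hdb | ⟨v, hv, hvb⟩
    · exact Or.inl hdb
    · rcases h2 with hbd | ⟨x, hx, hxd⟩
      · exact Or.inl (SimpleGraph.Reachable.symm hbd)
      · exact Or.inr ⟨⟨x, Finset.mem_coe.2 hx, SimpleGraph.Reachable.symm hxd⟩, v, hv, hvb⟩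
  · intro h
    rcases h with hdb | ⟨⟨x, hx, hdx⟩, v, hv, hvb⟩
    · exact reachable_glue_mono N (show (openGraph ω).Reachable d b from hdb)
    · have e1 : (openGraph (ω ∪ {e : Sym2 (Fin n) | (∀ x ∈ e, x ∈ N) ∧ ¬ e.IsDiag} : BondConfig (Fin n))).Reachable d x :=
        reachable_glue_mono N hdx
      have e2 : (openGraph (ω ∪ {e : Sym2 (Fin n) | (∀ x ∈ e, x ∈ N) ∧ ¬ e.IsDiag} : BondConfig (Fin n))).Reachable x v :=
        reachable_glue_of_mem N (Finset.mem_coe.1 hx) hv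
      have e3 : (openGraph (ω ∪ {e : Sym2 (Fin n) | (∀ x ∈ e, x ∈ N) ∧ ¬ e.IsDiag} : BondConfig (Fin n))).Reachable v b :=
        reachable_glue_mono N (show (openGraph ω).Reachable v b from hvb)
      exact (e1.trans e2).trans e3

/-- **`⋃_{v∈N} ⋃_{a∈A} {v ↔ a}` is invariant under gluing the block.** [folklore] -/
theorem glue_preimage_iUnion₂_openConn (N A : Finset (Fin n)) :
    {ω : BondConfig (Fin n) | (ω ∪ {e : Sym2 (Fin n) | (∀ x ∈ e, x ∈ N) ∧ ¬ e.IsDiag} : BondConfig (Fin n)) ∈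
        ⋃ v ∈ N, ⋃ a ∈ A, (openConn v a : Set (BondConfig (Fin n)))} = ⋃ v ∈ N, ⋃ a ∈ A, openConn v a := by
  ext ω
  simp only [Set.mem_setOf_eq, Set.mem_iUnion, exists_prop]
  constructor
  · rintro ⟨v, hv, a, ha, hva⟩
    rcases reachable_or_exists_mem_of_glue N hva with h | ⟨v', hv', h'⟩
    · exact ⟨v, hv, a, ha, h⟩
    · exact ⟨v', hv', a, ha, h'⟩
  · rintro ⟨v, hv, a, ha, hva⟩
    exact ⟨v, hv, a, ha, reachable_glue_mono N (show (openGraph ω).Reachable v a from hva)⟩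

/-- **`AdditiveGluing` for finger observers from the domination inequality.**  If for every finger block and every unglued-weakest designated
relay `d` some relay `u ∈ A` satisfies (DI) `μ_K(R ∩ {u↔b}) + μ_K(U ∩ {d↔N} ∩ {d↮b}) ≤ μ_K(U)`, then every observer `o ∉ A` whose non-relay
neighbours are pairwise non-adjacent fingers satisfies `μ(o ↔ A) − t ≤ μ(o ↔ b)` whenever `μ(a↔b) ≥ 1 − t` on `A`.
[cite: KozmaNitzan2024, Thm 4–5 and Lemma 5 (§3.2, pp. 12–14), eq. (3) p. 3] -/
theorem additiveGluing_fingers_of_domination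
    (w : Sym2 (Fin n) → unitInterval) (A : Finset (Fin n)) (o b : Fin n) (hb : b ∈ A) (ho : o ∉ A)
    (hDI : ∀ (K : Sym2 (Fin n) → unitInterval) (N : Finset (Fin n)) (d : Fin n),
      Disjoint N A → N.Nonempty → d ∈ A →
      (∀ v ∈ N, ∀ y : Fin n, y ∉ A → y ∉ N → (K s(v, y) : ℝ) = 0) →
      (∀ a ∈ A, (prodBernoulli K).real (openConn d b) ≤ (prodBernoulli K).real (openConn a b)) →
      ∃ u ∈ A, (prodBernoulli K).real ({ω : Set (Sym2 (Fin n)) | ∃ v ∈ N, ∃ a ∈ A, s(v, a) ∈ ω} ∩ openConn u b) +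
        (prodBernoulli K).real ((⋃ v ∈ N, openConn v b) ∩
          {ω : BondConfig (Fin n) | ∀ x ∈ (↑N : Set (Fin n)), ¬ (openGraph ω).Reachable d x}ᶜ ∩ (openConn d b)ᶜ) ≤
        (prodBernoulli K).real (⋃ v ∈ N, openConn v b))
    (hfing : ∀ x : Fin n, x ∉ A → x ≠ o → (w s(o, x) : ℝ) ≠ 0 →
      ∀ y : Fin n, y ∉ A → y ≠ o → y ≠ x → (w s(x, y) : ℝ) = 0) :
    ∀ t : ℝ, 0 ≤ t →
      (∀ a ∈ A, 1 - t ≤ (prodBernoulli w).real (openConn a b)) →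
      (prodBernoulli w).real (⋃ a ∈ A, openConn o a) - t ≤ (prodBernoulli w).real (openConn o b) := by
  refine additiveGluing_fingers_of_T_at w A o b hb ho ?_ hfing
  intro K N d hNA hN hd hfree hle
  obtain ⟨u, hu, hdom⟩ := hDI K N d hNA hN hd hfree hle
  set D : Set (Sym2 (Fin n)) := {e : Sym2 (Fin n) | (∀ x ∈ e, x ∈ N) ∧ ¬ e.IsDiag} with hD
  set M : Set (BondConfig (Fin n)) :=
    {ω : BondConfig (Fin n) | ∀ x ∈ (↑N : Set (Fin n)), ¬ (openGraph ω).Reachable d x} with hM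
  set R : Set (BondConfig (Fin n)) := {ω : Set (Sym2 (Fin n)) | ∃ v ∈ N, ∃ a ∈ A, s(v, a) ∈ ω} with hR
  set U : Set (BondConfig (Fin n)) := ⋃ v ∈ N, (openConn v b : Set (BondConfig (Fin n))) with hU
  set UA : Set (BondConfig (Fin n)) := ⋃ v ∈ N, ⋃ a ∈ A, (openConn v a : Set (BondConfig (Fin n))) with hUA
  set Db : Set (BondConfig (Fin n)) := openConn d b with hDb
  have hmeas : ∀ s : Set (BondConfig (Fin n)), MeasurableSet s := fun _ => MeasurableSet.of_discrete
  -- pull the glued measures back to `K`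
  rw [stub_gluePushforward n K N UAᶜ, stub_gluePushforward n K N U, stub_gluePushforward n K N Db]
  have eUA : {ω : BondConfig (Fin n) | (ω ∪ D : BondConfig (Fin n)) ∈ UAᶜ} = UAᶜ := by
    have h := glue_preimage_iUnion₂_openConn N A
    ext ω
    have hω := Set.ext_iff.1 h ω
    simp only [Set.mem_setOf_eq] at hω
    simp only [Set.mem_setOf_eq, Set.mem_compl_iff]
    exact not_congr hω
  have eU : {ω : BondConfig (Fin n) | (ω ∪ D : BondConfig (Fin n)) ∈ U} = U := glue_preimage_iUnion_openConn N b
  have eDb : {ω : BondConfig (Fin n) | (ω ∪ D : BondConfig (Fin n)) ∈ Db} = Db ∪ (Mᶜ ∩ U) := by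
    rw [hDb, glue_preimage_openConn_eq N d b]
    ext ω
    simp only [Set.mem_union, Set.mem_inter_iff, Set.mem_setOf_eq, Set.mem_compl_iff, hM]
    constructor
    · rintro (h | ⟨⟨x, hx, hdx⟩, hUω⟩)
      · exact Or.inl h
      · exact Or.inr ⟨fun hall => hall x hx hdx, hUω⟩
    · rintro (h | ⟨hnot, hUω⟩)
      · exact Or.inl h
      · refine Or.inr ⟨?_, hUω⟩
        by_contra hcon
        push Not at hcon
        exact hnot hcon
  rw [eUA, eU, eDb]
  -- (1) μ(Db ∪ (Mᶜ ∩ U)) ≤ μ(Db) + μ(U ∩ Mᶜ ∩ Dbᶜ)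
  have h1 : (prodBernoulli K).real (Db ∪ (Mᶜ ∩ U)) ≤
      (prodBernoulli K).real Db + (prodBernoulli K).real (U ∩ Mᶜ ∩ Dbᶜ) := by
    have hsub : Db ∪ (Mᶜ ∩ U) ⊆ Db ∪ (U ∩ Mᶜ ∩ Dbᶜ) := by
      intro ω hω
      by_cases hωD : ω ∈ Db
      · exact Or.inl hωD
      · rcases hω with h | ⟨hωM, hωU⟩
        · exact (hωD h).elim
        · exact Or.inr ⟨⟨hωU, hωM⟩, hωD⟩
    exact (measureReal_mono hsub (measure_ne_top _ _)).trans (measureReal_union_le _ _)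
  -- (2) the plain hypothesis at `u`
  have h2 : (prodBernoulli K).real Db ≤ (prodBernoulli K).real (openConn u b) := hle u hu
  -- (3) μ(u↔b) ≤ μ(R ∩ {u↔b}) + μ(Rᶜ)
  have h3 : (prodBernoulli K).real (openConn u b) ≤
      (prodBernoulli K).real (R ∩ openConn u b) + (prodBernoulli K).real Rᶜ := by
    have hs := measureReal_inter_add_sdiff (μ := prodBernoulli K) (s := (openConn u b : Set (BondConfig (Fin n)))) (hmeas R)
      (measure_ne_top _ _)
    have hle' : (prodBernoulli K).real ((openConn u b : Set (BondConfig (Fin n))) \ R) ≤ (prodBernoulli K).real Rᶜ :=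
      measureReal_mono (fun ω hω => hω.2) (measure_ne_top _ _)
    rw [Set.inter_comm] at hs
    linarith
  -- (4) off `R` no finger reaches a relay: μ(Rᶜ) ≤ μ(UAᶜ)
  have h4 : (prodBernoulli K).real Rᶜ ≤ (prodBernoulli K).real UAᶜ := by
    have hnull := finger_noContact_reach_null K A N hNA hfree
    have hs := measureReal_inter_add_sdiff (μ := prodBernoulli K) (s := Rᶜ) (hmeas UA) (measure_ne_top _ _)
    have hle' : (prodBernoulli K).real (Rᶜ \ UA) ≤ (prodBernoulli K).real UAᶜ :=
      measureReal_mono (fun ω hω => hω.2) (measure_ne_top _ _)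
    have h0 : (prodBernoulli K).real (Rᶜ ∩ UA) = 0 := hnull
    linarith
  linarith

end FingersDominationAG

end

end Summit.CriticalPhenomena.PercolationContinuityZ3.Theorems
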